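import Summits.ABC.ABC.Theses.DefiniteXi
import Summits.ABC.ABC.Theorems.EisensteinQuarantine.Negative.EisensteinQuarantineFalseOfProthDepthFamily
import Summits.ABC.ABC.Theorems.EisensteinQuarantine.Negative.EisensteinQuarantineFalseOfForcedPairOccurrence
import Literature.NumberTheory.EllipticCurves.SerreFreyValuationProductProofs
import Literature.NumberTheory.Sieve.DivisorBound
import HarnessLib

/-!
# Crux `XiStrongBound` (stmt-ABC-11337), line `SplitProof` (skeleton v4): the semistable Eisenstein-quarantine
# stub is false under the Proth–Legendre depth family

Death certificate of line `SplitProof` of the crux `Summit.ABC.ABC.Theses.DefiniteXi.XiStrongBound`, filed by the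
continuation lead c2 (2026-08-17).  Skeleton v4 (`Cruxes/XiStrongBound/Lines/SplitProof.lean`, sha `18db15a5afa0`)
composes the crux from three registered stubs by a case split on `Squarefree N`; its abc-free stub is

  `stub_eisensteinQuarantineSemistable` = the route crux `EisensteinQuarantine` (stmt-ABC-15023) with the extra
  hypothesis `Squarefree N` (the repair C′ proposed by refuter-rattack-stmt-ABC-15023-0, 2026-08-16T10:06Z).

The crux programme of stmt-ABC-15023 has since killed `EisensteinQuarantine` AS FILED on the Proth–Legendre family
`E_(−p, p−1)`, `p ≡ 1 (mod 2^s)`, `Nm = p` (census kits j016666, j017527; kernel-checked modulo the one arithmetic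
input `ProthDepthFamily`: `EisensteinQuarantine_false_of_ProthDepthFamily`, p107816).  That family is
Serre-normalised (`a = −p ≡ −1 (mod 4)`, `32 ∣ b = p − 1`), so its conductor `N = rad(p(p−1))` is SQUAREFREE
(`conductorNorm_freyCurve_serre` + `squarefree_radical`): the repair C′ does not remove a single counter-instance.
This file makes that kernel-checked: the proof of p107816 goes through verbatim for the restricted statement, the
new hypothesis `Squarefree N` being discharged by `squarefree_radical`.

Main results (hypotheses exactly those of the landed negative lemmas of stmt-ABC-15023):
* `eisensteinQuarantineSemistable_false_of_ProthDepthFamily : ProthDepthFamily → ¬ A′`;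
* `eisensteinQuarantineSemistable_false_of_ProthDepthLaw : ProthDepthLaw → ¬ A′` (prime supply = the tree's
  unconditional Gallagher theorem, via `prothDepthFamily_of_prothDepthLaw_unconditional`);
* `eisensteinQuarantineSemistable_false_of_ForcedPairOccurrence :
    takahashi2001_brandtEigenLattice_rank_one → FreyModularity → ForcedPairOccurrence → ¬ A′`.

## References

* [Mazur1977] B. Mazur, *Modular curves and the Eisenstein ideal*, Publ. Math. IHÉS 47 (1977) (index `num((p−1)/12)`).
* [Gallagher1970] P. X. Gallagher, Invent. Math. 11 (1970), Theorem 7.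
-/

-- `Summit.<Summit>.<Problem>`: for the single-conjunct summit `ABC` the duplicate `ABC.ABC` is mandated.
set_option linter.dupNamespace false

noncomputable section

open scoped BigOperators
open Literature.NumberTheory.Automorphic Literature.NumberTheory.EllipticCurves
open Summit.ABC.ABC.Theorems.EisensteinQuarantine.Negative
open Finset

namespace Summit.ABC.ABC.Theorems.XiStrongBound.Negative

/-- **Stub A′ of line `SplitProof` (semistable Eisenstein quarantine) is false under `ProthDepthFamily`.**
The statement refuted is VERBATIM the registered stub `stub_eisensteinQuarantineSemistable` of skeleton v4
(`EisensteinQuarantine` with `Squarefree N →` inserted after the conductor hypothesis).  Proof: that of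
`EisensteinQuarantine_false_of_ProthDepthFamily` (p107816) at `ε = δ = 1/(8A)`, `Nm = p`, `(a, b) = (−p, p−1)`;
the only new obligation, `Squarefree N` for `N = rad(p(p−1))`, is `squarefree_radical`. [folklore] -/
theorem eisensteinQuarantineSemistable_false_of_ProthDepthFamily (hD : ProthDepthFamily) :
    ¬ (∀ ε : ℝ, 0 < ε → ∃ C : ℝ, ∀ a b : ℤ, IsCoprime a b → a * b * (a + b) ≠ 0 →
      ∀ (N : ℕ) [NeZero N], (freyCurve a b).conductorNorm ℤ = N → Squarefree N →
        ∀ Nm : ℕ, Odd Nm → Squarefree Nm → Odd Nm.primeFactors.card → Nm ∣ N →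
          ((ordProj[2] (brandtXi (N / Nm) Nm (fun n => (freyCurve a b).LFunction n)) *
              ordProj[3] (brandtXi (N / Nm) Nm (fun n => (freyCurve a b).LFunction n)) : ℕ) : ℝ) ≤
            C * (N : ℝ) ^ ε *
              ((∏ q ∈ N.primeFactors \ Nm.primeFactors,
                  ((freyCurve a b).minimalDiscriminantNorm ℤ).factorization q : ℕ) : ℝ)) := by
  intro hEQ
  obtain ⟨c, A, hfam⟩ := hD
  -- exponents
  set A' : ℕ := max A 1 with hA'
  have hA'1 : 1 ≤ A' := le_max_right _ _
  have hA'R : (1 : ℝ) ≤ (A' : ℝ) := by exact_mod_cast hA'1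
  have hA'0 : (0 : ℝ) < (A' : ℝ) := by linarith
  have hAA' : (A : ℝ) ≤ (A' : ℝ) := by exact_mod_cast le_max_left A 1
  set t : ℝ := 1 / (8 * (A' : ℝ)) with ht
  have ht0 : 0 < t := by rw [ht]; positivity
  obtain ⟨C, hC⟩ := hEQ t ht0
  obtain ⟨Cd, hCd1, hCd⟩ := Literature.NumberTheory.Sieve.exists_card_divisors_le_mul_rpow ht0
  set C' : ℝ := max C 1 with hC'
  have hC'1 : 1 ≤ C' := le_max_right _ _
  have hC'0 : (0 : ℝ) ≤ C' := zero_le_one.trans hC'1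
  have hCd0 : (0 : ℝ) ≤ Cd := zero_le_one.trans hCd1
  -- the constant and the choice of `s`
  set K : ℝ := (2 : ℝ) ^ c * C' * Cd with hK
  have hK0 : 0 ≤ K := by rw [hK]; exact mul_nonneg (mul_nonneg (by positivity) hC'0) hCd0
  obtain ⟨n₀, hn₀⟩ := pow_unbounded_of_one_lt (K ^ 2) (by norm_num : (1 : ℝ) < 2)
  obtain ⟨s, p, hs₀, hp, hsp, hpA, hdep⟩ := hfam (max n₀ 5)
  have hs5 : 5 ≤ s := le_of_max_le_right hs₀
  have hKs : K ^ 2 < (2 : ℝ) ^ s := hn₀.trans_le (pow_le_pow_right₀ (by norm_num) (le_of_max_le_left hs₀))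
  have hp1le : 1 ≤ p := hp.one_lt.le
  have hM0 : p - 1 ≠ 0 := by have := hp.two_le; omega
  have h2s_le : 2 ^ s ≤ p - 1 := Nat.le_of_dvd (Nat.pos_of_ne_zero hM0) hsp
  have h32 : 2 ^ 5 ≤ p - 1 := (Nat.pow_le_pow_right (by norm_num) hs5).trans h2s_le
  norm_num at h32
  have hp2 : p ≠ 2 := by omega
  -- the Frey data `(a, b) = (−p, p−1)`
  set a : ℤ := -(p : ℤ) with ha
  set b : ℤ := ((p - 1 : ℕ) : ℤ) with hb
  have hpcast : (p : ℤ) = ((p - 1 : ℕ) : ℤ) + 1 := by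
    rw [Nat.cast_sub hp1le]; push_cast; ring
  have hab_sum : a + b = -1 := by rw [ha, hb, hpcast]; ring
  have habc : a * b * (a + b) = ((p * (p - 1) : ℕ) : ℤ) := by
    rw [hab_sum, ha, hb]; push_cast; ring
  have hPM0 : p * (p - 1) ≠ 0 := Nat.mul_ne_zero hp.ne_zero hM0
  have h0 : a * b * (a + b) ≠ 0 := by rw [habc]; exact_mod_cast hPM0
  have hab : IsCoprime a b := by
    rw [ha, hb, IsCoprime.neg_left_iff, Int.isCoprime_iff_gcd_eq_one, Int.gcd_natCast_natCast]
    exact (Nat.coprime_self_sub_right hp1le).mpr (Nat.coprime_one_right p)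
  have h4M : (4 : ℕ) ∣ p - 1 :=
    (Nat.pow_dvd_pow 2 (show 2 ≤ s by omega)).trans hsp
  have h32M : (32 : ℕ) ∣ p - 1 :=
    (Nat.pow_dvd_pow 2 hs5).trans hsp
  have ha4 : a ≡ -1 [ZMOD 4] := by
    have h4 : (4 : ℤ) ∣ b := by rw [hb]; exact_mod_cast h4M
    have : a = -1 - b := by rw [ha, hb, hpcast]; ring
    rw [this]
    calc -1 - b ≡ -1 - 0 [ZMOD 4] := Int.ModEq.sub_left _ ((Int.modEq_zero_iff_dvd).mpr h4)
      _ = -1 := by ring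
  have hb32 : (32 : ℤ) ∣ b := by rw [hb]; exact_mod_cast h32M
  have hnatAbs : (a * b * (a + b)).natAbs = p * (p - 1) := by rw [habc, Int.natAbs_natCast]
  -- the curve, its conductor (a radical, hence SQUAREFREE) and minimal discriminant
  set E := freyCurve a b with hE
  haveI : E.IsElliptic := isElliptic_freyCurve h0
  obtain ⟨N, hN⟩ : ∃ N : ℕ, E.conductorNorm ℤ = N := ⟨_, rfl⟩
  have hNval : N = UniqueFactorizationMonoid.radical (p * (p - 1)) := by
    rw [← hN, hE, conductorNorm_freyCurve_serre hab h0 ha4 hb32, hnatAbs]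
  have hNsq : Squarefree N := by rw [hNval]; exact UniqueFactorizationMonoid.squarefree_radical
  have hNpos : 0 < N := by rw [hNval]; exact Nat.radical_pos _
  haveI : NeZero N := ⟨hNpos.ne'⟩
  have hNle : N ≤ p * (p - 1) := by rw [hNval]; exact Nat.radical_le_self_iff.mpr hPM0
  have hpN : p ∣ N := by
    rw [hNval]
    refine Nat.dvd_of_mem_primeFactors ?_
    rw [Nat.primeFactors_radical, Nat.primeFactors_mul hp.ne_zero hM0, hp.primeFactors]
    simp
  have hfac : ∀ q : ℕ, (E.minimalDiscriminantNorm ℤ).factorization q =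
      2 * (p * (p - 1)).factorization q - if q = 2 then 8 else 0 := fun q => by
    rw [hE, factorization_minimalDiscriminantNorm_freyCurve_serre hab h0 ha4 hb32 q, hnatAbs]
  -- admissibility of `Nm := p` and the stub at this instance (the only change w.r.t. p107816: `hNsq`)
  have hPodd : Odd p := hp.odd_of_ne_two hp2
  have hPcard : Odd p.primeFactors.card := by rw [hp.primeFactors]; simp
  have hcrux := hC a b hab h0 N hN hNsq p hPodd hp.squarefree hPcard hpN
  obtain ⟨ξ, hξ⟩ : ∃ ξ : ℕ, brandtXi (N / p) p (fun n => E.LFunction n) = ξ := ⟨_, rfl⟩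
  change ((ordProj[2] (brandtXi (N / p) p (fun n => E.LFunction n)) *
      ordProj[3] (brandtXi (N / p) p (fun n => E.LFunction n)) : ℕ) : ℝ) ≤
    C * (N : ℝ) ^ t * ((∏ q ∈ N.primeFactors \ p.primeFactors,
      (E.minimalDiscriminantNorm ℤ).factorization q : ℕ) : ℝ) at hcrux
  rw [hξ] at hcrux
  -- the depth inequality at this instance
  have hdepth : 2 ^ s ≤ 2 ^ c * ordProj[2] ξ := by
    have h := hdep N hN
    change 2 ^ s ≤ 2 ^ c * ordProj[2] (brandtXi (N / p) p (fun n => E.LFunction n)) at h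
    rwa [hξ] at h
  -- the allowance: 𝓛 ≤ τ((p−1)²)
  have hLtau : (∏ q ∈ N.primeFactors \ p.primeFactors, (E.minimalDiscriminantNorm ℤ).factorization q) ≤
      #((p - 1) ^ 2).divisors := by
    have hsd : N.primeFactors \ p.primeFactors = (p - 1).primeFactors := by
      rw [hNval]; exact primeFactors_radical_mul_pred_sdiff hp
    rw [hsd]
    refine le_trans ?_ (prod_two_mul_factorization_le_card_divisors_sq hM0)
    refine prod_le_prod (fun _ _ => Nat.zero_le _) fun q hq => ?_
    rw [hfac q, factorization_mul_pred_of_mem hp hq]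
    exact Nat.sub_le _ _
  -- pass to ℝ
  have hpR : (0 : ℝ) < (p : ℝ) := by exact_mod_cast hp.pos
  have hX0 : (0 : ℝ) ≤ ((ordProj[2] ξ : ℕ) : ℝ) := by positivity
  have hY1 : (1 : ℝ) ≤ ((ordProj[3] ξ : ℕ) : ℝ) := by
    exact_mod_cast Nat.one_le_iff_ne_zero.mpr (Nat.ordProj_pos ξ 3).ne'
  have hNR : (0 : ℝ) < (N : ℝ) := by exact_mod_cast hNpos
  -- `N^t ≤ p^(2t)` and `τ ≤ Cd p^(2t)`
  have hp2R : ((p * (p - 1) : ℕ) : ℝ) ≤ (p : ℝ) ^ (2 : ℝ) := by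
    rw [Real.rpow_two]
    have : p * (p - 1) ≤ p * p := Nat.mul_le_mul_left _ (Nat.sub_le _ _)
    calc ((p * (p - 1) : ℕ) : ℝ) ≤ ((p * p : ℕ) : ℝ) := by exact_mod_cast this
      _ = (p : ℝ) ^ 2 := by push_cast; ring
  have hNt : (N : ℝ) ^ t ≤ (p : ℝ) ^ (2 * t) := by
    rw [Real.rpow_mul hpR.le]
    exact Real.rpow_le_rpow (Nat.cast_nonneg _) ((Nat.cast_le.mpr hNle).trans hp2R) ht0.le
  have hτ : (#((p - 1) ^ 2).divisors : ℝ) ≤ Cd * (p : ℝ) ^ (2 * t) := by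
    have h1 := hCd ((p - 1) ^ 2) (pow_ne_zero 2 hM0)
    have h2 : ((((p - 1) ^ 2 : ℕ)) : ℝ) ≤ (p : ℝ) ^ (2 : ℝ) := by
      rw [Real.rpow_two]; push_cast
      have : ((p - 1 : ℕ) : ℝ) ≤ (p : ℝ) := by exact_mod_cast Nat.sub_le p 1
      exact pow_le_pow_left₀ (Nat.cast_nonneg _) this 2
    calc (#((p - 1) ^ 2).divisors : ℝ) ≤ Cd * ((((p - 1) ^ 2 : ℕ)) : ℝ) ^ t := h1
      _ ≤ Cd * ((p : ℝ) ^ (2 : ℝ)) ^ t :=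
          mul_le_mul_of_nonneg_left (Real.rpow_le_rpow (Nat.cast_nonneg _) h2 ht0.le) hCd0
      _ = Cd * (p : ℝ) ^ (2 * t) := by rw [Real.rpow_mul hpR.le]
  -- `X ≤ C' · p^(2t) · Cd · p^(2t)`
  have hLR : ((∏ q ∈ N.primeFactors \ p.primeFactors, (E.minimalDiscriminantNorm ℤ).factorization q : ℕ) : ℝ) ≤
      Cd * (p : ℝ) ^ (2 * t) := (Nat.cast_le.mpr hLtau).trans hτ
  have hstep1 : ((ordProj[2] ξ : ℕ) : ℝ) ≤ C' * (p : ℝ) ^ (2 * t) * (Cd * (p : ℝ) ^ (2 * t)) := by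
    have hL0 : (0 : ℝ) ≤ ((∏ q ∈ N.primeFactors \ p.primeFactors,
        (E.minimalDiscriminantNorm ℤ).factorization q : ℕ) : ℝ) := by positivity
    calc ((ordProj[2] ξ : ℕ) : ℝ) ≤ ((ordProj[2] ξ : ℕ) : ℝ) * ((ordProj[3] ξ : ℕ) : ℝ) :=
          le_mul_of_one_le_right hX0 hY1
      _ = ((ordProj[2] ξ * ordProj[3] ξ : ℕ) : ℝ) := by push_cast; ring
      _ ≤ C * (N : ℝ) ^ t * ((∏ q ∈ N.primeFactors \ p.primeFactors,
            (E.minimalDiscriminantNorm ℤ).factorization q : ℕ) : ℝ) := hcrux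
      _ ≤ C' * (N : ℝ) ^ t * ((∏ q ∈ N.primeFactors \ p.primeFactors,
            (E.minimalDiscriminantNorm ℤ).factorization q : ℕ) : ℝ) :=
          mul_le_mul_of_nonneg_right
            (mul_le_mul_of_nonneg_right (le_max_left C 1) (Real.rpow_nonneg hNR.le _)) hL0
      _ ≤ C' * (p : ℝ) ^ (2 * t) * (Cd * (p : ℝ) ^ (2 * t)) :=
          mul_le_mul (mul_le_mul_of_nonneg_left hNt hC'0) hLR hL0
            (mul_nonneg hC'0 (Real.rpow_nonneg hpR.le _))
  -- `p^(4t) ≤ 2^(s/2)` along the family (`p ≤ 2^(A s)`, `4 t A ≤ 1/2`)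
  have hp4t : (p : ℝ) ^ (2 * t) * (p : ℝ) ^ (2 * t) = (p : ℝ) ^ (4 * t) := by
    rw [← Real.rpow_add hpR]; ring_nf
  set u : ℝ := (2 : ℝ) ^ ((s : ℝ) / 2) with hu
  have hu0 : 0 < u := by rw [hu]; positivity
  have huu : u * u = (2 : ℝ) ^ s := by
    rw [hu, ← Real.rpow_add (by norm_num : (0 : ℝ) < 2), ← Real.rpow_natCast (2 : ℝ) s]
    congr 1; ring
  have hpbound : (p : ℝ) ≤ (2 : ℝ) ^ (A * s) := by exact_mod_cast hpA
  have hexp_le : ((A * s : ℕ) : ℝ) * (4 * t) ≤ (s : ℝ) / 2 := by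
    have hA'ne : (A' : ℝ) ≠ 0 := hA'0.ne'
    have h1 : ((A * s : ℕ) : ℝ) * (4 * t) = (A : ℝ) / A' * ((s : ℝ) / 2) := by
      rw [ht]; push_cast; field_simp; ring
    rw [h1]
    exact mul_le_of_le_one_left (by positivity) ((div_le_one hA'0).mpr hAA')
  have hp4bound : (p : ℝ) ^ (4 * t) ≤ u := by
    have h4t : 0 ≤ 4 * t := by positivity
    calc (p : ℝ) ^ (4 * t) ≤ ((2 : ℝ) ^ (A * s)) ^ (4 * t) := Real.rpow_le_rpow hpR.le hpbound h4t
      _ = (2 : ℝ) ^ (((A * s : ℕ) : ℝ) * (4 * t)) := by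
          rw [← Real.rpow_natCast (2 : ℝ) (A * s), ← Real.rpow_mul (by norm_num : (0 : ℝ) ≤ 2)]
      _ ≤ (2 : ℝ) ^ ((s : ℝ) / 2) := Real.rpow_le_rpow_of_exponent_le (by norm_num) hexp_le
      _ = u := by rw [hu]
  -- combine: `u² = 2^s ≤ K · u`, so `2^s ≤ K²`, contradicting the choice of `s`
  have hdepthR : (2 : ℝ) ^ s ≤ (2 : ℝ) ^ c * ((ordProj[2] ξ : ℕ) : ℝ) := by exact_mod_cast hdepth
  have hfinal : (2 : ℝ) ^ s ≤ K * u := by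
    calc (2 : ℝ) ^ s ≤ (2 : ℝ) ^ c * ((ordProj[2] ξ : ℕ) : ℝ) := hdepthR
      _ ≤ (2 : ℝ) ^ c * (C' * (p : ℝ) ^ (2 * t) * (Cd * (p : ℝ) ^ (2 * t))) :=
          mul_le_mul_of_nonneg_left hstep1 (by positivity)
      _ = (2 : ℝ) ^ c * C' * Cd * (p : ℝ) ^ (4 * t) := by rw [← hp4t]; ring
      _ ≤ (2 : ℝ) ^ c * C' * Cd * u := mul_le_mul_of_nonneg_left hp4bound hK0
      _ = K * u := by rw [hK]
  rw [← huu] at hfinal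
  have huK : u ≤ K := le_of_mul_le_mul_right hfinal hu0
  have hsq : (2 : ℝ) ^ s ≤ K ^ 2 := by
    rw [← huu, sq]
    exact mul_le_mul huK huK hu0.le hK0
  linarith

/-- **Stub A′ is false under the uniform Proth–Legendre depth law alone** (prime supply: the tree's unconditional
Gallagher theorem, `prothDepthFamily_of_prothDepthLaw_unconditional`). [cite: Gallagher1970, Theorem 7] -/
theorem eisensteinQuarantineSemistable_false_of_ProthDepthLaw (hD : ProthDepthLaw) :
    ¬ (∀ ε : ℝ, 0 < ε → ∃ C : ℝ, ∀ a b : ℤ, IsCoprime a b → a * b * (a + b) ≠ 0 →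
      ∀ (N : ℕ) [NeZero N], (freyCurve a b).conductorNorm ℤ = N → Squarefree N →
        ∀ Nm : ℕ, Odd Nm → Squarefree Nm → Odd Nm.primeFactors.card → Nm ∣ N →
          ((ordProj[2] (brandtXi (N / Nm) Nm (fun n => (freyCurve a b).LFunction n)) *
              ordProj[3] (brandtXi (N / Nm) Nm (fun n => (freyCurve a b).LFunction n)) : ℕ) : ℝ) ≤
            C * (N : ℝ) ^ ε *
              ((∏ q ∈ N.primeFactors \ Nm.primeFactors,
                  ((freyCurve a b).minimalDiscriminantNorm ℤ).factorization q : ℕ) : ℝ)) :=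
  eisensteinQuarantineSemistable_false_of_ProthDepthFamily (prothDepthFamily_of_prothDepthLaw_unconditional hD)

/-- **Stub A′ is false under multiplicity one, modularity and the forced-pair occurrence** — the hypotheses of the
live negation line `forced-pair-dlog` of stmt-ABC-15023 (`prothDepthFamily_of_forcedPairOccurrence`). [cite: Mazur1977, II.16.6 and II.18.10] -/
theorem eisensteinQuarantineSemistable_false_of_ForcedPairOccurrence
    (hR : Literature.NumberTheory.EllipticCurves.takahashi2001_brandtEigenLattice_rank_one)
    (hM : Summit.ABC.ABC.Theses.DefiniteXi.FreyModularity) (hO : ForcedPairOccurrence) :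
    ¬ (∀ ε : ℝ, 0 < ε → ∃ C : ℝ, ∀ a b : ℤ, IsCoprime a b → a * b * (a + b) ≠ 0 →
      ∀ (N : ℕ) [NeZero N], (freyCurve a b).conductorNorm ℤ = N → Squarefree N →
        ∀ Nm : ℕ, Odd Nm → Squarefree Nm → Odd Nm.primeFactors.card → Nm ∣ N →
          ((ordProj[2] (brandtXi (N / Nm) Nm (fun n => (freyCurve a b).LFunction n)) *
              ordProj[3] (brandtXi (N / Nm) Nm (fun n => (freyCurve a b).LFunction n)) : ℕ) : ℝ) ≤
            C * (N : ℝ) ^ ε *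
              ((∏ q ∈ N.primeFactors \ Nm.primeFactors,
                  ((freyCurve a b).minimalDiscriminantNorm ℤ).factorization q : ℕ) : ℝ)) :=
  eisensteinQuarantineSemistable_false_of_ProthDepthFamily (prothDepthFamily_of_forcedPairOccurrence hR hM hO)

end Summit.ABC.ABC.Theorems.XiStrongBound.Negative

end
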